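import Summits.ResolutionOfSingularities.ResolutionOfSingularities.Theorems.UniformComplexityPrimeModelTransferFamilyResolutionSpreadLemmas
import Summits.ResolutionOfSingularities.ResolutionOfSingularities.Theorems.UniformComplexityCampaignW82FamilyResolution
import Summits.ResolutionOfSingularities.ResolutionOfSingularities.Theorems.UniversalCellsProductDescentFibreGenericPoint
import Literature.AlgebraicGeometry.Limits.SubalgebraSpread
import Literature.AlgebraicGeometry.Limits.LocalizationProperSpread
import Literature.AlgebraicGeometry.Limits.LocalizationSmoothSpread
import Literature.AlgebraicGeometry.Limits.GenericProperCover
import Literature.AlgebraicGeometry.Limits.GenericSmoothnessSpread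
import Literature.AlgebraicGeometry.Limits.GenericFibreSpread
import Literature.AlgebraicGeometry.Resolution.SmoothOfRegularPerfectField
import Literature.AlgebraicGeometry.Resolution.SmoothStalksRegular
import Literature.AlgebraicGeometry.Resolution.SmoothGenericFibreSpread
import Literature.AlgebraicGeometry.Morphisms.ReducedOfFlat
import Literature.AlgebraicGeometry.Morphisms.IsoOverOpen
import Mathlib.AlgebraicGeometry.Morphisms.LocalFlatDescent
import Mathlib.FieldTheory.IsAlgClosed.AlgebraicClosure
import Mathlib.RingTheory.Localization.Away.AdjoinRoot
import HarnessLib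

/-!
# Crux `PrimeModelTransfer` (stmt-ResolutionOfSingularities-8933), door 2 of slot W8.2:
# the crux ⇒ RESOLUTION IN FAMILIES — spreading a resolution of the geometric generic fibre

Route `ResolutionOfSingularities/UniformComplexity`. Second half of the kernel-checked equivalence
between the crux slice `CampaignW82.PrimeModelTransferAt p` and RESOLUTION IN FAMILIES over the prime
model (`CampaignW82.FamilyResolution`, OURS module p526769; «⇐» = p528212,
`Theorems/UniformComplexityPrimeModelTransferOfFamilyResolution.lean`; the corollary
`familyResolution_of_algClosedRes` and the by-name equivalences are in the links file
`Theorems/UniformComplexityCampaignW82FamilyResolutionLinks.lean`):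

* `exists_familyResolution_datum` — **spreading theorem**: `A` a Noetherian domain, `L` a perfect
  field algebraic over `A` with injective structure map, `f : 𝒳 → Spec A` proper with `𝒳 ×_A Spec L`
  integral and RESOLVABLE ⇒ the `∃`-clause of `FamilyResolution` for `f`. The proof is the
  specialization argument of p484634 / p522497 (EGA IV₃ 8.10.5, IV₄ 17.7.8: spread the resolution to
  a finitely generated `A`-subalgebra `R ⊆ L`, descend smoothness and properness to `Frac R`, spread
  them to `R[1/t]`) run over a genuine base `A` and at ALL points of an open: the new ingredient is
  the open `W ⊆ 𝒳 ×_A Spec R` over which the spread morphism is an isomorphism, found at the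
  (possibly non-generic) image `ξ` of the generic point of the generic fibre by the point-wise lemmas
  of `Theorems/UniformComplexityPrimeModelTransferFamilyResolutionSpreadLemmas.lean` (p528492), and
  Chevalley (`Limits.exists_basicOpen_subset_image`) making `W` surject onto a basic open `D(b)`.

[OURS · LADDER-RESOLUTION L1, slot W8.2 (prime-field / universality transfer), door 2
UniformComplexity] Theorem over the summit's own route and OURS names; NOT a statement of, and
attributing nothing to, Hironaka's 2017 manuscript. AI-written; weaker than expert review. Barrier
bookkeeping (`RegularNotGeometricallyRegular.lean`, `InseparableBaseChangeResolution.lean`,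
`FrobeniusTwistResolution.lean`): no resolution is base-changed along an inseparable extension — the
resolution lives over the perfect `L`, is SMOOTH there, descends along the flat cover
`Spec L → Spec Frac R` (fpqc descent of smoothness/properness) and is then only base-changed; the
inseparability of `Frac R / Frac A` is absorbed in the algebraic base extension `A → A' = R[1/t]`.

Sources: A. Grothendieck, J. Dieudonné, EGA IV₃ (1966) Thm. 8.8.2, 8.10.5; EGA IV₄ (1967) Prop. 17.7.8;
U. Görtz, T. Wedhorn, *Algebraic Geometry I* (2nd ed. 2020) Cor. 10.64 (2); The Stacks Project, Tags
01ZM, 081F, 054K. [cite: EGAIV3, Thm. 8.10.5] [cite: StacksProject, Tag 081F]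
[cite: GortzWedhorn2020, Cor. 10.64 (2)]
-/


noncomputable section

set_option linter.dupNamespace false -- mandated namespace of this single-conjunct summit

open CategoryTheory CategoryTheory.Limits AlgebraicGeometry TopologicalSpace
open Literature.AlgebraicGeometry.Resolution

namespace Summit.ResolutionOfSingularities.ResolutionOfSingularities.Theorems.PrimeModelTransfer

open MonoidalCategory CartesianMonoidalCategory
open Literature.AlgebraicGeometry.Limits Literature.AlgebraicGeometry.Limits.LocApprox
open Literature.AlgebraicGeometry.Motives (SchemeOver specOver)

set_option backward.isDefEq.respectTransparency false

/-- Over a locally Noetherian base, locally of finite type ⇒ locally of finite presentation. [folklore] -/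
private theorem lfp_of_isLocallyNoetherian {Y T : Scheme.{0}}
    (q : Y ⟶ T) [LocallyOfFiniteType q] [IsLocallyNoetherian T] :
    LocallyOfFinitePresentation q := by
  rw [HasRingHomProperty.iff_appLE (P := @LocallyOfFinitePresentation)]
  intro U V e
  haveI := IsLocallyNoetherian.component_noetherian (X := T) U
  exact RingHom.FinitePresentation.of_finiteType.mp
    (HasRingHomProperty.appLE @LocallyOfFiniteType q inferInstance U V e)

/-- **SPREADING A RESOLUTION OF THE GEOMETRIC GENERIC FIBRE.** Let `A` be a Noetherian domain,
`L` a PERFECT field with an INJECTIVE, ALGEBRAIC structure map `A → L` (e.g. `L = (Frac A)^{alg}`),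
and `f : 𝒳 → Spec A` proper such that `X_L := 𝒳 ×_A Spec L` is integral and HAS A RESOLUTION. Then
there are a finite-type, algebraic, injective extension `A → A'` of domains and
`G : 𝒴 → 𝒳 ×_A Spec A'` all of whose field-valued fibres are weak resolutions
(`CampaignW82.IsWeakResolution`) — the `∃`-clause of `CampaignW82.FamilyResolution` for `f`. Proof:
(1) a resolution `π : Y → X_L` has `Y` smooth and proper over `L`, and is an isomorphism over a dense
open `U`; (2) spread `π` to `G : Y_R → X_R := 𝒳 ×_A Spec R` over a finitely generated `A`-subalgebra
`R ⊆ L` (`Limits.exists_isPullback_whisker_of_hom_tensorObj`); (3) over the generic fibre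
`X_{F'} = X_R ×_R Spec F'`, `F' = Frac R` — an INTEGRAL scheme, `X_L` being its flat surjective base
change — the base change `G_{F'}` is an isomorphism at the generic point (fpqc descent from `π`,
`isIso_pullback_snd_fromSpecStalk_genericPoint_of_isPullback`), hence `G` is an isomorphism over
`Spec 𝒪_{X_R,ξ}`, `ξ` the image of that generic point (the inclusion of the generic fibre is a flat
preimmersion, `isIso_pullback_snd_fromSpecStalk_of_flat_of_isPreimmersion`), hence over an open
`W ∋ ξ` of `X_R` (`exists_mem_isIso_morphismRestrict_of_isIso_pullback_snd_fromSpecStalk`), and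
`f_R(W) ⊇ D(b)` for some `b ≠ 0` (Chevalley, `Limits.exists_basicOpen_subset_image`);
(4) `Y_{F'} → Spec F'` is smooth and proper by fpqc descent from `L`, so `Y_R ⊗ R[1/t] → Spec R[1/t]`
is smooth and proper for a suitable `t` with `b ∣ t` (`LocApprox.exists_forall_smooth_snd`, Chow cover
`exists_proper_generic_cover` + `isProper_snd_of_generic_cover`); (5) `A' := R[1/t]`, and the base
change of `G` to `𝒳 ×_A Spec A'` has, at every field-valued point `φ : A' → Ω`, a fibre which is
proper with smooth (hence regular) source and an isomorphism over the preimage of `W`, non-empty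
because `φ(b) ≠ 0`. This is the specialization argument of p484634 / p522497 run over a genuine
base `A` and at ALL points of an open instead of one closed point. [cite: EGAIV3, Thm. 8.10.5]
[cite: StacksProject, Tag 081F] [cite: GortzWedhorn2020, Cor. 10.64 (2)] -/
theorem exists_familyResolution_datum (A : Type) [CommRing A] [IsDomain A] [IsNoetherianRing A]
    (L : Type) [Field L] [PerfectField L] [Algebra A L] [Algebra.IsAlgebraic A L]
    (hAL : Function.Injective (algebraMap A L))
    (𝒳 : Scheme.{0}) (f : 𝒳 ⟶ Spec (.of A)) [hf : IsProper f]
    (hint : IsIntegral (pullback f (Spec.map (CommRingCat.ofHom (algebraMap A L)))))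
    (hY : Scheme.HasResolution (pullback f (Spec.map (CommRingCat.ofHom (algebraMap A L))))) :
    ∃ (A' : Type) (_ : CommRing A') (_ : IsDomain A') (_ : Algebra A A'),
      Function.Injective (algebraMap A A') ∧ Algebra.FiniteType A A' ∧ Algebra.IsAlgebraic A A' ∧
      ∃ (𝒴 : Scheme.{0})
        (G : 𝒴 ⟶ pullback f (Spec.map (CommRingCat.ofHom (algebraMap A A')))),
        ∀ (Ω : Type) [Field Ω] (φ : A' →+* Ω),
          CampaignW82.IsWeakResolution
            (pullback.snd G
              (pullback.fst (pullback.snd f (Spec.map (CommRingCat.ofHom (algebraMap A A'))))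
                (Spec.map (CommRingCat.ofHom φ)))) := by
  classical
  -- ### Step 1: the geometric generic fibre `X_L` and its resolution
  let X₀ : SchemeOver A := Over.mk f
  haveI : IsProper X₀.hom := hf
  haveI : QuasiCompact X₀.hom := inferInstance
  haveI : IsSeparated X₀.hom := inferInstance
  haveI : LocallyOfFinitePresentation X₀.hom := lfp_of_isLocallyNoetherian f
  let XL : Scheme.{0} := (X₀ ⊗ specOver A L).left
  let fL : XL ⟶ Spec (.of L) := pullback.snd X₀.hom (specOver A L).hom
  haveI : IsIntegral XL := hint
  haveI : IsProper fL := inferInstance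
  obtain ⟨Y, π, hresol⟩ : ∃ (Y : Scheme.{0}) (π : Y ⟶ XL), IsResolution π := hY
  haveI := hresol.isProper
  obtain ⟨U, hUd, hUpre, hUiso⟩ := hresol.isBirational
  haveI := hUiso
  haveI : IrreducibleSpace Y := IsBirational.irreducibleSpace ⟨U, hUd, hUpre, hUiso⟩
  haveI : IsReduced Y := hresol.isRegular.isReduced
  haveI : IsIntegral Y := isIntegral_of_irreducibleSpace_of_isReduced Y
  haveI hYsm : Smooth (π ≫ fL) := smooth_of_isRegular_of_perfectField (π ≫ fL) hresol.isRegular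
  haveI hYpr : IsProper (π ≫ fL) := inferInstance
  have hUξ : genericPoint XL ∈ U := by
    haveI : Nonempty U := (hUd.nonempty).to_subtype
    exact ((genericPoint_spec XL).mem_open_set_iff U.isOpen).mpr (by simpa using ‹Nonempty U›)
  -- ### Step 2: spread `π` out over a finitely generated `A`-subalgebra `R ⊆ L`
  obtain ⟨R, _, _, ψ, YR, G, πR, ℓ, hψ, hRft, hGsep, hGlft, hGqc, hℓ₁, hℓ₂, hsq⟩ :=
    exists_isPullback_whisker_of_hom_tensorObj (K := A) (B := L) X₀ π
  haveI := hRft; haveI := hGsep; haveI := hGlft; haveI := hGqc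
  haveI : IsDomain R := Function.Injective.isDomain ψ.toRingHom hψ
  haveI : IsNoetherianRing R := Algebra.FiniteType.isNoetherianRing A R
  let XR : Scheme.{0} := (X₀ ⊗ specOver A R).left
  let fR : XR ⟶ Spec (.of R) := pullback.snd X₀.hom (specOver A R).hom
  let iψ : Spec (.of L) ⟶ Spec (.of R) := Spec.map (CommRingCat.ofHom ψ.toRingHom)
  have hiψ : iψ ≫ (specOver A R).hom = (specOver A L).hom := by
    change Spec.map _ ≫ Spec.map _ = Spec.map _
    rw [← Spec.map_comp, ← CommRingCat.ofHom_comp]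
    congr 2
    exact ψ.comp_algebraMap
  haveI : IsNoetherian XR := isNoetherian_of_locallyOfFiniteType fR
  haveI : IsProper fR := inferInstance
  -- the square `X_L → X_R` over `Spec L → Spec R`
  have hsqℓ : IsPullback ℓ fL fR iψ := by
    refine IsPullback.of_right (h₁₂ := pullback.fst X₀.hom (specOver A R).hom) (v₁₃ := f)
      (h₂₂ := (specOver A R).hom) ?_ hℓ₂ (IsPullback.of_hasPullback X₀.hom (specOver A R).hom)
    rw [hℓ₁, hiψ]
    exact IsPullback.of_hasPullback X₀.hom (specOver A L).hom
  -- ### Step 3: the generic fibre over `F' = Frac R`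
  let qR : YR ⟶ Spec (.of R) := G ≫ fR
  haveI : IsSeparated qR := inferInstance
  haveI : LocallyOfFiniteType qR := inferInstance
  haveI : QuasiCompact qR := inferInstance
  let P : SchemeOver R := Over.mk qR
  haveI : QuasiCompact P.hom := ‹QuasiCompact qR›
  haveI : IsSeparated P.hom := ‹IsSeparated qR›
  haveI : QuasiSeparated P.hom := inferInstance
  haveI : LocallyOfFiniteType P.hom := ‹LocallyOfFiniteType qR›
  haveI : LocallyOfFinitePresentation P.hom := lfp_of_isLocallyNoetherian qR
  have hsqY : IsPullback πR (π ≫ fL) qR iψ := by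
    have h := hsq.paste_vert hsqℓ
    exact h
  let F' : Type := FractionRing R
  letI : Algebra R L := ψ.toRingHom.toAlgebra
  have hψ' : Function.Injective (algebraMap R L) := hψ
  let φL : F' →+* L := IsFractionRing.lift hψ'
  let iF : Spec (.of F') ⟶ Spec (.of R) := Spec.map (CommRingCat.ofHom (algebraMap R F'))
  let jF : Spec (.of L) ⟶ Spec (.of F') := Spec.map (CommRingCat.ofHom φL)
  have hjF : jF ≫ iF = iψ := by
    change Spec.map _ ≫ Spec.map _ = Spec.map _
    rw [← Spec.map_comp, ← CommRingCat.ofHom_comp]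
    congr 2
    exact RingHom.ext fun x => IsFractionRing.lift_algebraMap hψ' x
  -- `Y_{F'}` and descent of smoothness / properness from `L`
  let YF : Scheme.{0} := pullback P.hom iF
  let qF : YF ⟶ Spec (.of F') := pullback.snd P.hom iF
  let m : Y ⟶ YF := pullback.lift πR ((π ≫ fL) ≫ jF) (by rw [Category.assoc, hjF]; exact hsqY.w)
  have hsqYF : IsPullback m (π ≫ fL) qF jF := by
    have outer : IsPullback (m ≫ pullback.fst P.hom iF) (π ≫ fL) qR (jF ≫ iF) := by
      rw [pullback.lift_fst, hjF]; exact hsqY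
    exact outer.of_right (pullback.lift_snd _ _ _) (IsPullback.of_hasPullback P.hom iF)
  haveI : Subsingleton ↥(Spec (CommRingCat.of F')) := inferInstanceAs (Subsingleton (PrimeSpectrum F'))
  haveI : Subsingleton ↥(Spec (CommRingCat.of L)) := inferInstanceAs (Subsingleton (PrimeSpectrum L))
  haveI : Nonempty ↥(Spec (CommRingCat.of L)) := inferInstanceAs (Nonempty (PrimeSpectrum L))
  haveI : Flat jF := by
    letI : Algebra F' L := φL.toAlgebra
    haveI hflat : Module.Flat F' L := inferInstance
    rw [show jF = Spec.map (CommRingCat.ofHom (algebraMap F' L)) from rfl, Flat.SpecMap_iff,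
      CommRingCat.hom_ofHom]
    exact RingHom.flat_algebraMap_iff.mpr hflat
  haveI : Surjective jF := inferInstance
  have hQ : (@Surjective ⊓ @Flat ⊓ @QuasiCompact : MorphismProperty Scheme.{0}) jF :=
    ⟨⟨‹Surjective jF›, ‹Flat jF›⟩, inferInstance⟩
  haveI hsmF : Smooth qF :=
    MorphismProperty.of_isPullback_of_descendsAlong (P := @Smooth) hsqYF.flip hQ hYsm
  haveI : UniversallyClosed qF :=
    MorphismProperty.of_isPullback_of_descendsAlong (P := @UniversallyClosed) hsqYF.flip hQ
      inferInstance
  haveI : IsSeparated qF := inferInstance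
  haveI : LocallyOfFiniteType qF := inferInstance
  haveI hprF : IsProper qF := ⟨⟩
  haveI : Flat m := MorphismProperty.of_isPullback (P := @Flat) hsqYF.flip ‹Flat jF›
  haveI : Surjective m :=
    MorphismProperty.of_isPullback (P := @Surjective) hsqYF.flip ‹Surjective jF›
  haveI : IsReduced YF := Literature.AlgebraicGeometry.Morphisms.isReduced_of_flat_of_surjective m
  haveI : IrreducibleSpace YF := Function.Surjective.irreducibleSpace m.continuous m.surjective
  haveI : IsIntegral YF := isIntegral_of_irreducibleSpace_of_isReduced YF
  -- `X_{F'}`: integral, with `X_L → X_{F'}` flat surjective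
  let XF : Scheme.{0} := pullback fR iF
  let gF : XF ⟶ XR := pullback.fst fR iF
  let fF : XF ⟶ Spec (.of F') := pullback.snd fR iF
  let mX : XL ⟶ XF := pullback.lift ℓ (fL ≫ jF) (by rw [Category.assoc, hjF]; exact hsqℓ.w)
  have hsqmX : IsPullback mX fL fF jF := by
    have outer : IsPullback (mX ≫ gF) fL fR (jF ≫ iF) := by
      rw [pullback.lift_fst, hjF]; exact hsqℓ
    exact outer.of_right (pullback.lift_snd _ _ _) (IsPullback.of_hasPullback fR iF)
  haveI : Flat mX := MorphismProperty.of_isPullback (P := @Flat) hsqmX.flip ‹Flat jF›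
  haveI : Surjective mX :=
    MorphismProperty.of_isPullback (P := @Surjective) hsqmX.flip ‹Surjective jF›
  haveI : IsReduced XF := Literature.AlgebraicGeometry.Morphisms.isReduced_of_flat_of_surjective mX
  haveI : IrreducibleSpace XF := Function.Surjective.irreducibleSpace mX.continuous mX.surjective
  haveI : IsIntegral XF := isIntegral_of_irreducibleSpace_of_isReduced XF
  -- `G_{F'} : Y ×_{X_R} X_{F'} → X_{F'}` and the square `Y → Y ×_{X_R} X_{F'}` over `X_L → X_{F'}`
  let GF : pullback G gF ⟶ XF := pullback.snd G gF
  let πF : Y ⟶ pullback G gF := pullback.lift πR (π ≫ mX) (by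
    rw [Category.assoc, pullback.lift_fst]; exact hsq.w)
  have hsqF : IsPullback πF π GF mX := by
    have s : IsPullback (πF ≫ pullback.fst G gF) π G (mX ≫ gF) := by
      rw [pullback.lift_fst, pullback.lift_fst]; exact hsq
    exact s.of_right (pullback.lift_snd _ _ _) (IsPullback.of_hasPullback G gF)
  have hmXξ : mX (genericPoint XL) = genericPoint XF :=
    ProductDescent.Birth.apply_genericPoint_of_surjective mX
  haveI : IsLocallyNoetherian XF := LocallyOfFiniteType.isLocallyNoetherian fF
  haveI : LocallyOfFinitePresentation GF := lfp_of_isLocallyNoetherian GF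
  haveI : QuasiSeparated GF := inferInstance
  haveI hisoF : IsIso (pullback.snd GF (XF.fromSpecStalk (genericPoint XF))) :=
    isIso_pullback_snd_fromSpecStalk_genericPoint_of_isPullback hsqF hmXξ U hUξ
  -- ### Step 4: `G` is an isomorphism over an open `W ∋ ξ := g_{F'}(η)` of `X_R`, `f_R(W) ⊇ D(b)`
  haveI : Flat iF := Literature.AlgebraicGeometry.Resolution.flat_specMap_fractionRing (A := R) F'
  haveI : IsPreimmersion iF :=
    Literature.AlgebraicGeometry.Resolution.isPreimmersion_specMap_fractionRing (A := R) F'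
  haveI : Flat gF := MorphismProperty.pullback_fst _ _ inferInstance
  haveI : IsPreimmersion gF := MorphismProperty.pullback_fst _ _ inferInstance
  haveI : IsIso (pullback.snd G (XR.fromSpecStalk (gF (genericPoint XF)))) :=
    isIso_pullback_snd_fromSpecStalk_of_flat_of_isPreimmersion G gF (genericPoint XF)
  haveI : LocallyOfFinitePresentation G := lfp_of_isLocallyNoetherian G
  haveI : QuasiSeparated G := inferInstance
  obtain ⟨W, hξW, hWiso⟩ :=
    exists_mem_isIso_morphismRestrict_of_isIso_pullback_snd_fromSpecStalk G (gF (genericPoint XF))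
  haveI := hWiso
  have hfRξ : fR (gF (genericPoint XF)) = (⊥ : PrimeSpectrum R) := by
    rw [← Scheme.Hom.comp_apply, pullback.condition, Scheme.Hom.comp_apply]
    apply PrimeSpectrum.ext
    change Ideal.comap (algebraMap R F') (fF (genericPoint XF)).asIdeal = ⊥
    rw [Ideal.eq_bot_of_prime (fF (genericPoint XF)).asIdeal]
    exact Ideal.comap_bot_of_injective _ (IsFractionRing.injective R F')
  have hWc : Topology.IsConstructible (W : Set XR) :=
    IsRetrocompact.isConstructible W.isOpen (fun V _ _ => NoetherianSpace.isCompact _)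
  haveI : LocallyOfFinitePresentation fR := lfp_of_isLocallyNoetherian fR
  obtain ⟨b, hb0, hbW⟩ := exists_basicOpen_subset_image fR hWc ⟨_, hξW, hfRξ⟩
  -- ### Step 5: smoothness and properness spread from `F'` to a stage `R[1/t]`, `b ∣ t`
  obtain ⟨s₂, hs₂S, hs₂⟩ := LocApprox.exists_forall_smooth_snd (nonZeroDivisors R) F' P hsmF
  let E : SchemeOver F' := (Over.pullback (specOver R F').hom).obj P
  haveI : IsProper E.hom := hprF
  haveI : IsIntegral E.left := ‹IsIntegral YF›
  obtain ⟨Yc, a, hYc, ha⟩ := exists_proper_generic_cover P E (Iso.refl _)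
  haveI := hYc
  haveI : QuasiCompact Yc.hom := inferInstance
  haveI : QuasiSeparated Yc.hom := inferInstance
  obtain ⟨s₁, g, hg⟩ := LocApprox.exists_whiskerLeft_comp_eq F' (S := nonZeroDivisors R) (P := Yc) a
  let t : Idx (nonZeroDivisors R) :=
    ⟨s₁.val * s₂ * b, mul_mem (mul_mem s₁.mem hs₂S) (mem_nonZeroDivisors_of_ne_zero hb0)⟩
  have ht₁ : t ≤ s₁ := Idx.le_iff.mpr (dvd_mul_of_dvd_left (dvd_mul_right _ _) _)
  have ht₂ : s₂ ∣ t.val := dvd_mul_of_dvd_left (dvd_mul_left _ _) _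
  have htb : b ∣ t.val := dvd_mul_left _ _
  haveI hsmt : Smooth (pullback.snd P.hom ((baseDiagram (nonZeroDivisors R)).obj t).hom) :=
    hs₂ t.val ht₂ (loc (nonZeroDivisors R) t)
  haveI : Flat (pullback.snd P.hom ((baseDiagram (nonZeroDivisors R)).obj t).hom) := inferInstance
  haveI : IsSeparated (pullback.snd P.hom ((baseDiagram (nonZeroDivisors R)).obj t).hom) :=
    inferInstance
  have hgt : (Yc ◁ leg (nonZeroDivisors R) F' t) ≫ ((Yc ◁ (baseDiagram _).map (homOfLE ht₁)) ≫ g) = a := by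
    rw [← MonoidalCategory.whiskerLeft_comp_assoc, leg_comp_map, hg]
  have ha' : Function.Surjective (lift ((Yc ◁ leg (nonZeroDivisors R) F' t) ≫
      ((Yc ◁ (baseDiagram _).map (homOfLE ht₁)) ≫ g)) (snd Yc (specOver R F'))).left := by
    rw [hgt]; exact ha
  haveI hprt : IsProper (pullback.snd P.hom ((baseDiagram (nonZeroDivisors R)).obj t).hom) :=
    isProper_snd_of_generic_cover (B := F') le_rfl Yc P t _ ha'
  let Rt : Type := Localization.Away t.val
  let it : Spec (.of Rt) ⟶ Spec (.of R) := Spec.map (CommRingCat.ofHom (algebraMap R Rt))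
  let qt : pullback qR it ⟶ Spec (.of Rt) := pullback.snd qR it
  haveI : Smooth qt := hsmt
  haveI : IsProper qt := hprt
  have ht0 : t.val ≠ 0 := nonZeroDivisors.ne_zero t.mem
  have htle : Submonoid.powers t.val ≤ nonZeroDivisors R := powers_le_nonZeroDivisors_of_noZeroDivisors ht0
  haveI : IsDomain Rt := IsLocalization.isDomain_of_le_nonZeroDivisors Rt htle
  -- ### Step 6: the witnesses `A' := R[1/t]`, `𝒴 := Y_R ×_{X_R} 𝒳'`, `𝒳' := 𝒳 ×_A Spec R[1/t]`
  have hARt : algebraMap A Rt = (algebraMap R Rt).comp (algebraMap A R) :=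
    IsScalarTower.algebraMap_eq A R Rt
  have hAR : Function.Injective (algebraMap A R) := fun x y hxy => hAL (by
    rw [← ψ.comp_algebraMap, RingHom.comp_apply, RingHom.comp_apply, hxy])
  let ιt : Spec (.of Rt) ⟶ Spec (.of A) := Spec.map (CommRingCat.ofHom (algebraMap A Rt))
  have hιt : ιt = it ≫ (specOver A R).hom := by
    change Spec.map _ = Spec.map _ ≫ Spec.map _
    rw [← Spec.map_comp, ← CommRingCat.ofHom_comp, hARt]
  let 𝒳' : Scheme.{0} := pullback f ιt
  let f' : 𝒳' ⟶ Spec (.of Rt) := pullback.snd f ιt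
  let gt : 𝒳' ⟶ XR := pullback.lift (pullback.fst f ιt) (f' ≫ it)
    (by rw [Category.assoc, ← hιt]; exact pullback.condition)
  have hsqt : IsPullback gt f' fR it := by
    have outer : IsPullback (gt ≫ pullback.fst X₀.hom (specOver A R).hom) f' f (it ≫ (specOver A R).hom) := by
      rw [pullback.lift_fst, ← hιt]; exact IsPullback.of_hasPullback f ιt
    exact outer.of_right (pullback.lift_snd _ _ _) (IsPullback.of_hasPullback X₀.hom (specOver A R).hom)
  let 𝒴 : Scheme.{0} := pullback G gt
  let Gd : 𝒴 ⟶ 𝒳' := pullback.snd G gt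
  refine ⟨Rt, inferInstance, inferInstance, inferInstance, ?_, inferInstance, ?_, 𝒴, Gd, ?_⟩
  · rw [hARt]; exact (IsLocalization.injective Rt htle).comp hAR
  · haveI : Algebra.IsAlgebraic A R := Algebra.IsAlgebraic.of_injective ψ hψ
    haveI : Algebra.IsAlgebraic R Rt := IsLocalization.isAlgebraic Rt (Submonoid.powers t.val)
    exact Algebra.IsAlgebraic.trans A R Rt
  -- ### Step 7: the fibre at a field-valued point `φ : R[1/t] → Ω`
  intro Ω _ φ
  let cφ : Spec (.of Ω) ⟶ Spec (.of Rt) := Spec.map (CommRingCat.ofHom φ)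
  let Xφ : Scheme.{0} := pullback f' cφ
  let gφ : Xφ ⟶ 𝒳' := pullback.fst f' cφ
  let pφ : Xφ ⟶ Spec (.of Ω) := pullback.snd f' cφ
  let Gφ : pullback Gd gφ ⟶ Xφ := pullback.snd Gd gφ
  change CampaignW82.IsWeakResolution Gφ
  -- the fibre is a base change of the smooth proper `Y_R ⊗ R[1/t] → Spec R[1/t]`
  have HG : IsPullback (pullback.fst Gd gφ ≫ pullback.fst G gt) Gφ G (gφ ≫ gt) := by
    have h := (IsPullback.of_hasPullback Gd gφ).paste_horiz (IsPullback.of_hasPullback G gt)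
    exact h
  have Hc : IsPullback (gφ ≫ gt) pφ fR (cφ ≫ it) := by
    have h := (IsPullback.of_hasPullback f' cφ).paste_horiz hsqt
    exact h
  have Hq : IsPullback (pullback.fst Gd gφ ≫ pullback.fst G gt) (Gφ ≫ pφ) qR (cφ ≫ it) := by
    have h := HG.paste_vert Hc
    exact h
  let u : pullback Gd gφ ⟶ pullback qR it :=
    pullback.lift (pullback.fst Gd gφ ≫ pullback.fst G gt) ((Gφ ≫ pφ) ≫ cφ)
      (by rw [Category.assoc]; exact Hq.w)
  have Hqt : IsPullback u (Gφ ≫ pφ) qt cφ := by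
    have outer : IsPullback (u ≫ pullback.fst qR it) (Gφ ≫ pφ) qR (cφ ≫ it) := by
      rw [pullback.lift_fst]; exact Hq
    exact outer.of_right (pullback.lift_snd _ _ _) (IsPullback.of_hasPullback qR it)
  haveI : Smooth (Gφ ≫ pφ) := MorphismProperty.of_isPullback (P := @Smooth) Hqt ‹Smooth qt›
  haveI : IsProper (Gφ ≫ pφ) := MorphismProperty.of_isPullback (P := @IsProper) Hqt ‹IsProper qt›
  haveI : IsProper f' := inferInstance
  haveI : IsSeparated pφ := inferInstance
  haveI : IsProper Gφ := IsProper.of_comp Gφ pφ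
  have hreg : Scheme.IsRegular (pullback Gd gφ) := fun y =>
    isRegularLocalRing_stalk_of_smooth_of_field (Gφ ≫ pφ) y
  -- `G_φ` is an isomorphism over the preimage of `W`
  haveI : IsIso (Gd ∣_ (gt ⁻¹ᵁ W)) :=
    Literature.AlgebraicGeometry.Morphisms.isIso_morphismRestrict_pullback_snd G gt W
  haveI : IsIso (Gφ ∣_ (gφ ⁻¹ᵁ (gt ⁻¹ᵁ W))) :=
    Literature.AlgebraicGeometry.Morphisms.isIso_morphismRestrict_pullback_snd Gd gφ (gt ⁻¹ᵁ W)
  -- which is non-empty: `φ(b) ≠ 0`, so the point `Spec Ω → Spec R` lies in `D(b) ⊆ f_R(W)`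
  haveI : Nonempty ↥(Spec (CommRingCat.of Ω)) := inferInstanceAs (Nonempty (PrimeSpectrum Ω))
  let pt : ↥(Spec (CommRingCat.of Ω)) := Nonempty.some inferInstance
  have hbunit : IsUnit (algebraMap R Rt b) :=
    isUnit_of_dvd_unit (map_dvd (algebraMap R Rt) htb) (IsLocalization.Away.algebraMap_isUnit t.val)
  have hφb : (φ.comp (algebraMap R Rt)) b ≠ 0 := (hbunit.map φ).ne_zero
  have hcit : cφ ≫ it = Spec.map (CommRingCat.ofHom (φ.comp (algebraMap R Rt))) := by
    change Spec.map _ ≫ Spec.map _ = _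
    rw [← Spec.map_comp, ← CommRingCat.ofHom_comp]
  have hpt : (cφ ≫ it) pt ∈ (PrimeSpectrum.basicOpen b : Set (PrimeSpectrum R)) := by
    rw [hcit]
    exact (specMap_mem_basicOpen_iff _ b pt).mpr hφb
  obtain ⟨w, hwW, hw⟩ := hbW hpt
  obtain ⟨z, hz, -⟩ := Scheme.Pullback.exists_preimage_pullback (f := fR) (g := cφ ≫ it) w pt hw
  have hz' : (gφ ≫ gt) (Hc.isoPullback.inv z) = w := by
    rw [← Scheme.Hom.comp_apply, IsPullback.isoPullback_inv_fst]; exact hz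
  have hne : ((gφ ⁻¹ᵁ (gt ⁻¹ᵁ W) : Xφ.Opens) : Set Xφ).Nonempty :=
    ⟨Hc.isoPullback.inv z, show gt (gφ (Hc.isoPullback.inv z)) ∈ W by
      rw [← Scheme.Hom.comp_apply, hz']; exact hwW⟩
  exact ⟨inferInstance, hreg, gφ ⁻¹ᵁ (gt ⁻¹ᵁ W), hne, inferInstance⟩


end Summit.ResolutionOfSingularities.ResolutionOfSingularities.Theorems.PrimeModelTransfer

end
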